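import Mathlib.Analysis.SpecialFunctions.Pow.Real
import Literature.NumberTheory.LFunctions.SemimultiplicativeMoebiusKatai
import HarnessLib

/-!
# `LiouvilleOrthogonalTC0` (stmt-QuantumAdvantage-1393), line `Sketch` — stub `stub_pieces`

Crux `Summit.QuantumAdvantage.QuantumAdvantage.Theses.MobiusLadder.LiouvilleOrthogonalTC0`, line
`Sketch` (card multiplicative-xor-ladder), stub `stub_pieces` ("few prime-free intervals"), PROVED
unconditionally from the tree's Turán–Kubilius inequality over a finite set of primes,
`Literature.NumberTheory.LFunctions.Konieczny.turanKubilius_variance`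
(`∑_{N<X} (ω_𝓟(N) - A)² ≤ 2 X A + 4 (#𝓟)²`, `A = ∑_{p ∈ 𝓟} 1/p`), and finite (Markov) counting:

* `StubPieces.card_filter_coprime_le` — one heavy window: if all elements of `P` are primes `≤ M`
  and `∑_{p ∈ P} 1/p ≥ L₀ ≥ 1`, then `#{N < X : no p ∈ P divides N} ≤ 2X/L₀ + 4M²/L₀²`
  (on such `N` the Turán–Kubilius summand is `A² ≥ L₀²`; `#P ≤ M`);
* `StubPieces.markov_half` — `k · #{a ∈ s : k ≤ 2·#{i : P i a}} ≤ 2 ∑_i #{a ∈ s : P i a}`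
  (swap the double sum of indicators);
* `StubPieces.card_filter_half_le` — hence a uniform bound `C` on each `#{a ∈ s : P i a}` gives
  `#{a ∈ s : k ≤ 2·#{i : P i a}} ≤ 2C` for `k ≥ 1`;
* `stub_pieces` — the registered stub: `#{N < 2ⁿ : k ≤ 2·#{i : ∀ p ∈ I i, p ∤ N}} ≤
  4·2ⁿ/L₀ + 8M²/L₀²`.
-/

set_option linter.dupNamespace false -- D-0017: single-problem summit ⇒ `QuantumAdvantage.QuantumAdvantage` by design

noncomputable section

namespace Summit.QuantumAdvantage.QuantumAdvantage.Theorems.LiouvilleOrthogonalTC0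

open Finset

namespace StubPieces

/-- **One heavy prime window (Turán–Kubilius).** If every element of `P` is a prime `≤ M` and
`∑_{p ∈ P} 1/p ≥ L₀ ≥ 1`, then the number of `N < X` divisible by no `p ∈ P` is
`≤ 2X/L₀ + 4M²/L₀²`: on such `N` the summand of
`Literature.NumberTheory.LFunctions.Konieczny.turanKubilius_variance` is `A²`, `A = ∑_{p∈P} 1/p`,
so `B · A² ≤ 2XA + 4(#P)²` with `#P ≤ M` and `A ≥ L₀`. -/
theorem card_filter_coprime_le (X M : ℕ) (L₀ : ℝ) (hL : 1 ≤ L₀) (P : Finset ℕ)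
    (hP : ∀ p ∈ P, p.Prime ∧ p ≤ M) (hPL : L₀ ≤ ∑ p ∈ P, (1 : ℝ) / p) :
    (#((range X).filter fun N => ∀ p ∈ P, ¬ p ∣ N) : ℝ) ≤
      2 * (X : ℝ) / L₀ + 4 * (M : ℝ) ^ 2 / L₀ ^ 2 := by
  have hTK := Literature.NumberTheory.LFunctions.Konieczny.turanKubilius_variance P
    (fun p hp => (hP p hp).1) X
  set A : ℝ := ∑ p ∈ P, (1 : ℝ) / p with hA_def
  have hL0 : 0 < L₀ := by linarith
  have hA0 : 0 < A := by linarith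
  have hcard : (#P : ℝ) ≤ M := by
    have hsub : P ⊆ Icc 1 M := fun p hp => mem_Icc.2 ⟨(hP p hp).1.one_lt.le, (hP p hp).2⟩
    have h := card_le_card hsub
    rw [Nat.card_Icc, Nat.add_sub_cancel] at h
    exact_mod_cast h
  have hBA : (#((range X).filter fun N => ∀ p ∈ P, ¬ p ∣ N) : ℝ) * A ^ 2 ≤
      2 * X * A + 4 * (#P : ℝ) ^ 2 := by
    calc (#((range X).filter fun N => ∀ p ∈ P, ¬ p ∣ N) : ℝ) * A ^ 2
        = ∑ _N ∈ (range X).filter (fun N => ∀ p ∈ P, ¬ p ∣ N), A ^ 2 := by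
          rw [sum_const, nsmul_eq_mul]
      _ = ∑ N ∈ (range X).filter (fun N => ∀ p ∈ P, ¬ p ∣ N),
            ((#(P.filter (· ∣ N)) : ℝ) - A) ^ 2 := by
          refine sum_congr rfl fun N hN => ?_
          have h0 : P.filter (· ∣ N) = ∅ :=
            filter_eq_empty_iff.2 fun p hp => (mem_filter.1 hN).2 p hp
          rw [h0, card_empty, Nat.cast_zero, zero_sub, neg_sq]
      _ ≤ ∑ N ∈ range X, ((#(P.filter (· ∣ N)) : ℝ) - A) ^ 2 :=
          sum_le_sum_of_subset_of_nonneg (filter_subset _ _) fun _ _ _ => sq_nonneg _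
      _ ≤ 2 * X * A + 4 * (#P : ℝ) ^ 2 := hTK
  have hB1 : (#((range X).filter fun N => ∀ p ∈ P, ¬ p ∣ N) : ℝ) ≤
      2 * X / A + 4 * (#P : ℝ) ^ 2 / A ^ 2 := by
    rw [div_add_div _ _ hA0.ne' (pow_pos hA0 2).ne', le_div_iff₀ (by positivity)]
    calc (#((range X).filter fun N => ∀ p ∈ P, ¬ p ∣ N) : ℝ) * (A * A ^ 2)
        = (#((range X).filter fun N => ∀ p ∈ P, ¬ p ∣ N) : ℝ) * A ^ 2 * A := by ring
      _ ≤ (2 * X * A + 4 * (#P : ℝ) ^ 2) * A := by gcongr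
      _ = 2 * X * A ^ 2 + A * (4 * (#P : ℝ) ^ 2) := by ring
  calc (#((range X).filter fun N => ∀ p ∈ P, ¬ p ∣ N) : ℝ)
      ≤ 2 * X / A + 4 * (#P : ℝ) ^ 2 / A ^ 2 := hB1
    _ ≤ 2 * X / L₀ + 4 * (M : ℝ) ^ 2 / L₀ ^ 2 := by gcongr

/-- **Markov over the windows (in `ℕ`).** `k · #{a ∈ s : k ≤ 2 · #{i : P i a}} ≤
2 · ∑_i #{a ∈ s : P i a}`: bound `k` by `2 · #{i : P i a}` on the filter, enlarge to all of `s`,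
and swap the double sum of indicators. [folklore] -/
theorem markov_half {α : Type*} (s : Finset α) (k : ℕ) (P : Fin k → α → Prop)
    [∀ i, DecidablePred (P i)] :
    k * #(s.filter fun a => k ≤ 2 * #(univ.filter fun i => P i a)) ≤
      2 * ∑ i, #(s.filter fun a => P i a) := by
  calc k * #(s.filter fun a => k ≤ 2 * #(univ.filter fun i => P i a))
      = ∑ _a ∈ s.filter (fun a => k ≤ 2 * #(univ.filter fun i => P i a)), k := by
        rw [sum_const, smul_eq_mul, mul_comm]
    _ ≤ ∑ a ∈ s.filter (fun a => k ≤ 2 * #(univ.filter fun i => P i a)),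
          2 * #(univ.filter fun i => P i a) :=
        sum_le_sum fun a ha => (mem_filter.1 ha).2
    _ ≤ ∑ a ∈ s, 2 * #(univ.filter fun i => P i a) :=
        sum_le_sum_of_subset_of_nonneg (filter_subset _ _) fun _ _ _ => Nat.zero_le _
    _ = 2 * ∑ i, #(s.filter fun a => P i a) := by
        rw [← mul_sum]
        congr 1
        simp only [card_filter]
        exact sum_comm

/-- **Markov, real form.** If `k ≥ 1` and each `#{a ∈ s : P i a} ≤ C`, then
`#{a ∈ s : k ≤ 2 · #{i : P i a}} ≤ 2C`. [folklore] -/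
theorem card_filter_half_le {α : Type*} (s : Finset α) {k : ℕ} (hk : 1 ≤ k)
    (P : Fin k → α → Prop) [∀ i, DecidablePred (P i)] {C : ℝ}
    (hC : ∀ i, (#(s.filter fun a => P i a) : ℝ) ≤ C) :
    (#(s.filter fun a => k ≤ 2 * #(univ.filter fun i => P i a)) : ℝ) ≤ 2 * C := by
  have hM : (k : ℝ) * #(s.filter fun a => k ≤ 2 * #(univ.filter fun i => P i a)) ≤
      2 * ∑ i, (#(s.filter fun a => P i a) : ℝ) := by
    exact_mod_cast markov_half s k P
  have hk0 : (0 : ℝ) < k := by exact_mod_cast hk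
  refine le_of_mul_le_mul_left ?_ hk0
  calc (k : ℝ) * #(s.filter fun a => k ≤ 2 * #(univ.filter fun i => P i a))
      ≤ 2 * ∑ i, (#(s.filter fun a => P i a) : ℝ) := hM
    _ ≤ 2 * ∑ _i : Fin k, C := by
        gcongr with i _
        exact hC i
    _ = k * (2 * C) := by
        rw [sum_const, card_univ, Fintype.card_fin, nsmul_eq_mul]
        ring

end StubPieces

/-- **Stub `stub_pieces` (few prime-free intervals) — PROVED.** For `k ≥ 1` finite sets of primes
`I i`, all elements `≤ M`, each with `∑_{p ∈ I i} 1/p ≥ L₀ ≥ 1`, the number of `N < 2ⁿ` that are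
coprime to ALL primes of at least half of the `I i` is `≤ 4·2ⁿ/L₀ + 8M²/L₀²`: for each `i`,
Turán–Kubilius (`Literature.NumberTheory.LFunctions.Konieczny.turanKubilius_variance`) bounds the
`N < 2ⁿ` with no prime factor in `I i` by `2·2ⁿ/L₀ + 4M²/L₀²`
(`StubPieces.card_filter_coprime_le`), then Markov over `i` (`StubPieces.card_filter_half_le`). -/
theorem stub_pieces (k n M : ℕ) (hk : 1 ≤ k) (L₀ : ℝ) (hL : 1 ≤ L₀) (I : Fin k → Finset ℕ)
    (hI : ∀ i, ∀ p ∈ I i, p.Prime ∧ p ≤ M) (hIL : ∀ i, L₀ ≤ ∑ p ∈ I i, (1 : ℝ) / p) :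
    (#((range (2 ^ n)).filter fun N =>
        k ≤ 2 * #(univ.filter fun i : Fin k => ∀ p ∈ I i, ¬ p ∣ N)) : ℝ) ≤
      4 * 2 ^ n / L₀ + 8 * (M : ℝ) ^ 2 / L₀ ^ 2 := by
  refine (StubPieces.card_filter_half_le (range (2 ^ n)) hk (fun i N => ∀ p ∈ I i, ¬ p ∣ N)
    fun i => StubPieces.card_filter_coprime_le (2 ^ n) M L₀ hL (I i) (hI i) (hIL i)).trans
    (le_of_eq ?_)
  push_cast
  ring

end Summit.QuantumAdvantage.QuantumAdvantage.Theorems.LiouvilleOrthogonalTC0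

end
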